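import Summits.BirchSwinnertonDyer.BirchSwinnertonDyer.Theorems.KatoDescentTamePotSupersingularJetchevIrreducibleCoreVertexExistence
import Summits.BirchSwinnertonDyer.BirchSwinnertonDyer.Theorems.KatoDescentTamePotSupersingularJetchevIrreducibleCoreVertexBridgesAtP
import Summits.BirchSwinnertonDyer.BirchSwinnertonDyer.Theorems.KatoDescentPotSupersingularWildJetchevBoundAtPGross1991NamedFacts
import Summits.BirchSwinnertonDyer.BirchSwinnertonDyer.Theorems.KatoDescentTamePotSupersingularJetchevIrreducibleReadingThm52Gross1991NamedFacts
import HarnessLib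

/-!
# Cruxes `JetchevIrreducibleReadingByName` (20165, shared K8-t′ 19982 / K9 19197) / `WildJetchevBoundAtP` (19941): the registered stub S3′
# `stub_coreVertexExistenceIrredP` at every level `m > m(c)`, and with it the DIVISIBILITY readings S2 (20165) / S2p (19941), FROM THE
# REGISTERED S2′ AND THREE NAMED LITERATURE FACTS ONLY {Gross 1991 Prop. 3.7 (2), Poitou–Tate for the tree's Selmer structures,
# [GZ86 III (3.1)] image-free} — the irreducible K5 strike ASSEMBLED

Cell `bsd-potss`, seat `bsd-potss-k9-c4` g10; `--supports stmt-BirchSwinnertonDyer-20165`, helper; route-free; four theorems (pure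
compositions); CONDITIONAL on the displayed reading S2′ (`Sig.stub_prop52IrredP`, McCallum Prop. 5.2 irreducible — the one prover
target left on this line, k8t-c4's lane) and on the three named facts; nothing booked, no item closed, BSD is not proved by any of this.

* `coreVertexExistenceIrredP_lt_of_Gross1991_of_prop47P2 (h47P2) (hPT) (hF1)` — S3′-lt ⟸ {h47P2, Poitou–Tate} + [GZ86 III (3.1)] by name
  (`HeegnerE0ImageFree.forall_hGZ_of_Gross1991_imageFree`, p546756);
* `coreVertexExistenceIrredP_lt_of_prop37_2_of_poitouTate_of_Gross1991 (h37) (hPT) (hF1)` — **S3′-lt from THREE NAMED FACTS** (∘ k8t-c4's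
  `JetchevIrreducibleProp44.h47P2_of_prop37_2`, p541604);
* `divisibilityIrredAddv_of_prop52IrredP_of_namedFacts (h52I) (h37) (hPT) (hF1)` — S2 of 20165 (`Sig.S2DivisibilityIrredAddv`, body verbatim) ⟸
  S2′ + the three facts (bridge `…CoreVertexBridges` §2, node `…Thm52Gross1991NamedFacts`, ring class fields `JET.numberField_ringClassField`);
* `divisibilityAtP_of_prop52IrredP_of_namedFacts (h52I) (h37) (hPT) (hF1)` — S2p of 19941 likewise (`…CoreVertexBridgesAtP`,
  `…WildJetchevBoundAtPGross1991NamedFacts`).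
ACCOUNTING (candidate skeletons v7e / v5e filed as evidence): 20165 ⟸ S1 (`stub_structureIrred`, MN19 Thm. 0.7 held by name) ∧ S2′
(`stub_prop52IrredP`) ∧ `stub_prop37_2` ∧ `stub_poitouTate_GZ31` ∧ `stub_publishedInputsHeegner`; 19941 the same ∧ `stub_gaussianSupplement`.
References: [cite: Jetchev2008, Thm. 1.4, Prop. 5.3, Thm. 5.2, Cor. 1.5] [cite: McCallumLMS1991, §4 Prop. 4.4, §5 Prop. 5.2]
[cite: GrossLMS1991, Prop. 3.7 (2), §6 p. 245] [cite: GrossZagier1986, III (3.1)] [cite: MilneADT2006, Ch. I, Thm. 4.10(b)] [cite: Nekovar2007, Prop. 4.13 (ii)].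
-/

set_option autoImplicit false
-- the Theorems directory repeats the summit name (sibling precedent `KatoDescentPotSupersingularAssembly.lean`)
set_option linter.dupNamespace false

noncomputable section

open scoped Classical NumberField Pointwise

namespace Summit.BirchSwinnertonDyer.BirchSwinnertonDyer.Theorems.JetchevIrreducibleCoreVertex

open WeierstrassCurve IsDedekindDomain NumberField Field Literature.NumberTheory.EllipticCurves
  Literature.NumberTheory.EllipticCurves.ModularForms Literature.NumberTheory.EllipticCurves.Jetchev2008
  Literature.NumberTheory.EllipticCurves.Rank1Residual
  Literature.NumberTheory.GaloisRepresentations Literature.NumberTheory.GaloisCohomology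
  Literature.NumberTheory.GaloisRepresentations.DiscreteGaloisModule
  Summit.BirchSwinnertonDyer.Rank1Residual Summit.BirchSwinnertonDyer.Rank1Residual.X11b
  Summit.BirchSwinnertonDyer.Rank1Residual.X11b.Three
  Summit.BirchSwinnertonDyer.Rank1Residual.JET Summit.BirchSwinnertonDyer.Rank1Residual.JET.SelmerVocabulary
  Literature.NumberTheory.Automorphic
  Summit.BirchSwinnertonDyer.BirchSwinnertonDyer.Theorems

/-- **S3′-lt ⟸ {`h47P2`, Poitou–Tate} + [GZ86 III (3.1)] image-free BY NAME.** [cite: Jetchev2008, Prop. 5.3 (p. 823)]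
[cite: GrossLMS1991, §6, proof of Prop. 6.2 (1), p. 245] [cite: GrossZagier1986, III (3.1)] -/
theorem coreVertexExistenceIrredP_lt_of_Gross1991_of_prop47P2
    (h47P2 : ∀ (W : WeierstrassCurve ℚ) [W.IsElliptic] [W.IsGloballyMinimal] [NeZero (W.conductorNorm ℤ)],
        ¬ W.HasCM →
        ∀ (K : Type) [Field K] [NumberField K], IsImaginaryQuadratic K →
        NumberField.discr K ≠ -3 → NumberField.discr K ≠ -4 →
        SatisfiesHeegnerHypothesis (W.conductorNorm ℤ) K →
        ∀ (p : ℕ) [Fact p.Prime], p ≠ 2 → W.HasIrreducibleModPGaloisRep p → (p : ℤ) ∣ W.conductorNorm ℤ →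
        ∀ (Dt : ModularParametrizationData W (W.conductorNorm ℤ)) (β : ℤ) (ι : K →+* ℂ)
          (M : ℕ), 1 ≤ M →
        ∀ (m l : ℕ), Squarefree (m * l) → l.Prime → l ≠ 2 → ¬ l ∣ m →
          (∀ l' ∈ (m * l).primeFactors, Zhang2014.IsKolyvaginPrime (W.conductorNorm ℤ) W K p l' ∧
            M ≤ Zhang2014.kolyvaginIndex W p l') →
        ∀ (d : KolyvaginHeegnerData Dt β ι m) (d' : KolyvaginHeegnerData Dt β ι (m * l)),
          (∀ l' ∈ m.primeFactors, ∀ (x : ringClassField K ι m) (x' : ringClassField K ι (m * l)),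
            (x : ℂ) = x' → ((d'.σ l' x' : ringClassField K ι (m * l)) : ℂ) = (d.σ l' x : ℂ)) →
          (∀ s ∈ d.S, ∃ s' ∈ d'.S, ∀ (x : ringClassField K ι m) (x' : ringClassField K ι (m * l)),
            (x : ℂ) = x' → ((s' x' : ringClassField K ι (m * l)) : ℂ) = (s x : ℂ)) →
          (∀ s' ∈ d'.S, ∃ s ∈ d.S, ∀ (x : ringClassField K ι m) (x' : ringClassField K ι (m * l)),
            (x : ℂ) = x' → ((s' x' : ringClassField K ι (m * l)) : ℂ) = (s x : ℂ)) →
          (∀ (x : ringClassField K ι m) (x' : ringClassField K ι (m * l)),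
            (x : ℂ) = x' → d'.emb x' = d.emb x) →
        ∀ (v : HeightOneSpectrum (𝓞 K)), (l : 𝓞 K) ∈ v.asIdeal →
        ∀ (j : ℕ),
          (((p ^ j : ℕ) : ℤ) • d'.kolyvaginClass (Fact.out : p.Prime) M ∈
              (W.baseChange K).torsionLocalKer (v.adicCompletion K) ((p ^ M : ℕ) : ℤ) ↔
            ((p ^ j : ℕ) : ℤ) • d.kolyvaginClass (Fact.out : p.Prime) M ∈
              (W.baseChange K).torsionLocalKer (v.adicCompletion K) ((p ^ M : ℕ) : ℤ)))
    (hPT : ∀ (K : Type) [Field K] [NumberField K], poitouTate_selmerStructure_duality_conj K)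
    (hF1 : Gross1991_heegnerPoint_sub_ratTorsion_mem_E0_imageFree) :
    ∀ (W : WeierstrassCurve ℚ) [W.IsElliptic] [W.IsGloballyMinimal] [NeZero (W.conductorNorm ℤ)],
      ¬ W.HasCM →
      ∀ (K : Type) [Field K] [NumberField K], IsImaginaryQuadratic K →
      NumberField.discr K ≠ -3 → NumberField.discr K ≠ -4 →
      SatisfiesHeegnerHypothesis (W.conductorNorm ℤ) K →
      ∀ (τ : K ≃ₐ[ℚ] K), τ ≠ 1 →
      ∀ (p : ℕ) [Fact p.Prime], p ≠ 2 → W.HasIrreducibleModPGaloisRep p → (p : ℤ) ∣ W.conductorNorm ℤ →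
      ∀ (Dt : ModularParametrizationData W (W.conductorNorm ℤ)) (β : ℤ) (ι : K →+* ℂ)
        [∀ k : ℕ, NumberField (ringClassField K ι k)]
        (d₁ : KolyvaginHeegnerData Dt β ι 1), ¬ IsOfFinAddOrder d₁.derivedPoint →
      ∀ (m : ℕ), 1 ≤ m →
      ∀ (c : ℕ) (d : KolyvaginHeegnerData Dt β ι c), Squarefree c →
        (∀ ℓ ∈ c.primeFactors, Zhang2014.IsKolyvaginPrime (W.conductorNorm ℤ) W K p ℓ) →
      ∀ (s : ℕ), s < m → ¬ IsOfFinAddOrder d.derivedPoint →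
        (∃ Q : (W.baseChange (ringClassField K ι c)).toAffine.Point,
          ((p ^ s : ℕ) : ℤ) • Q = d.derivedPoint) →
        (¬ ∃ Q : (W.baseChange (ringClassField K ι c)).toAffine.Point,
          ((p ^ (s + 1) : ℕ) : ℤ) • Q = d.derivedPoint) →
        ((s + m : ℕ) : ℕ∞) ≤ Zhang2014.levelIndex W p c →
        ∃ (c' : ℕ) (d' : KolyvaginHeegnerData Dt β ι c'), Squarefree c' ∧
          (∀ ℓ ∈ c'.primeFactors, Zhang2014.IsKolyvaginPrime (W.conductorNorm ℤ) W K p ℓ ∧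
            m + s ≤ Zhang2014.kolyvaginIndex W p ℓ) ∧
          IsGlobalCoreVertex W K ι τ p m c' ∧
          ¬ IsOfFinAddOrder d'.derivedPoint ∧
          ¬ ∃ Q : (W.baseChange (ringClassField K ι c')).toAffine.Point,
            ((p ^ (s + 1) : ℕ) : ℤ) • Q = d'.derivedPoint :=
  coreVertexExistenceIrredP_lt_of_prop47P2_of_poitouTate_of_GZ31g h47P2 hPT
    (HeegnerE0ImageFree.forall_hGZ_of_Gross1991_imageFree hF1)

/-- **S3′ at every level `m > m(c)` — Jetchev 2008 Prop. 5.3 in the irreducible reading, `p ∣ N_E` — from THREE NAMED LITERATURE FACTS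
ONLY**: `GrossLMS1991.prop37_2_frobeniusCongruence` (Gross 1991 Prop. 3.7 (2) / Nekovář 2007 Prop. 4.13 (ii)),
`poitouTate_selmerStructure_duality_conj` (Poitou–Tate for the tree's Selmer structures, ∀ K) and
`Gross1991_heegnerPoint_sub_ratTorsion_mem_E0_imageFree` ([GZ86 III (3.1)] / Gross p. 245). CONDITIONAL on the three facts; nothing asserted.
[cite: Jetchev2008, Prop. 5.3 (p. 823), Rem. 6.2] [cite: GrossLMS1991, Prop. 3.7 (2), §6 p. 245] [cite: MilneADT2006, Ch. I, Thm. 4.10(b)] -/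
theorem coreVertexExistenceIrredP_lt_of_prop37_2_of_poitouTate_of_Gross1991
    (h37 : GrossLMS1991.prop37_2_frobeniusCongruence)
    (hPT : ∀ (K : Type) [Field K] [NumberField K], poitouTate_selmerStructure_duality_conj K)
    (hF1 : Gross1991_heegnerPoint_sub_ratTorsion_mem_E0_imageFree) :
    ∀ (W : WeierstrassCurve ℚ) [W.IsElliptic] [W.IsGloballyMinimal] [NeZero (W.conductorNorm ℤ)],
      ¬ W.HasCM →
      ∀ (K : Type) [Field K] [NumberField K], IsImaginaryQuadratic K →
      NumberField.discr K ≠ -3 → NumberField.discr K ≠ -4 →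
      SatisfiesHeegnerHypothesis (W.conductorNorm ℤ) K →
      ∀ (τ : K ≃ₐ[ℚ] K), τ ≠ 1 →
      ∀ (p : ℕ) [Fact p.Prime], p ≠ 2 → W.HasIrreducibleModPGaloisRep p → (p : ℤ) ∣ W.conductorNorm ℤ →
      ∀ (Dt : ModularParametrizationData W (W.conductorNorm ℤ)) (β : ℤ) (ι : K →+* ℂ)
        [∀ k : ℕ, NumberField (ringClassField K ι k)]
        (d₁ : KolyvaginHeegnerData Dt β ι 1), ¬ IsOfFinAddOrder d₁.derivedPoint →
      ∀ (m : ℕ), 1 ≤ m →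
      ∀ (c : ℕ) (d : KolyvaginHeegnerData Dt β ι c), Squarefree c →
        (∀ ℓ ∈ c.primeFactors, Zhang2014.IsKolyvaginPrime (W.conductorNorm ℤ) W K p ℓ) →
      ∀ (s : ℕ), s < m → ¬ IsOfFinAddOrder d.derivedPoint →
        (∃ Q : (W.baseChange (ringClassField K ι c)).toAffine.Point,
          ((p ^ s : ℕ) : ℤ) • Q = d.derivedPoint) →
        (¬ ∃ Q : (W.baseChange (ringClassField K ι c)).toAffine.Point,
          ((p ^ (s + 1) : ℕ) : ℤ) • Q = d.derivedPoint) →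
        ((s + m : ℕ) : ℕ∞) ≤ Zhang2014.levelIndex W p c →
        ∃ (c' : ℕ) (d' : KolyvaginHeegnerData Dt β ι c'), Squarefree c' ∧
          (∀ ℓ ∈ c'.primeFactors, Zhang2014.IsKolyvaginPrime (W.conductorNorm ℤ) W K p ℓ ∧
            m + s ≤ Zhang2014.kolyvaginIndex W p ℓ) ∧
          IsGlobalCoreVertex W K ι τ p m c' ∧
          ¬ IsOfFinAddOrder d'.derivedPoint ∧
          ¬ ∃ Q : (W.baseChange (ringClassField K ι c')).toAffine.Point,
            ((p ^ (s + 1) : ℕ) : ℤ) • Q = d'.derivedPoint :=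
  coreVertexExistenceIrredP_lt_of_Gross1991_of_prop47P2 (JetchevIrreducibleProp44.h47P2_of_prop37_2 h37) hPT hF1

/-- **S2 of crux 20165 (`Sig.S2DivisibilityIrredAddv`, body VERBATIM: Jetchev Thm. 1.4 (ii) in the irreducible reading) ⟸ the registered
reading S2′ (`h52I` = `Sig.stub_prop52IrredP`, McCallum Prop. 5.2 irreducible) + THREE NAMED FACTS.** Bridge `…CoreVertexBridges` §2 fed with
S3′-lt and the node `Sig.H63IRowObjectsAddv`, both from the three facts; ring class fields are number fields by `JET.numberField_ringClassField`.
CONDITIONAL; nothing asserted. [cite: Jetchev2008, Thm. 1.4 (ii), Prop. 5.3, Thm. 5.2] [cite: McCallumLMS1991, §5 Prop. 5.2 (p. 304)] -/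
theorem divisibilityIrredAddv_of_prop52IrredP_of_namedFacts
    (h52I : ∀ (W : WeierstrassCurve ℚ) [W.IsElliptic] [W.IsGloballyMinimal] [NeZero (W.conductorNorm ℤ)],
        ¬ W.HasCM →
        ∀ (K : Type) [Field K] [NumberField K], IsImaginaryQuadratic K →
        NumberField.discr K ≠ -3 → NumberField.discr K ≠ -4 →
        SatisfiesHeegnerHypothesis (W.conductorNorm ℤ) K →
        ∀ (p : ℕ) [Fact p.Prime], p ≠ 2 → W.HasIrreducibleModPGaloisRep p → (p : ℤ) ∣ W.conductorNorm ℤ →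
        ∀ (Dt : ModularParametrizationData W (W.conductorNorm ℤ)) (β : ℤ) (ι : K →+* ℂ)
          (d₁ : KolyvaginHeegnerData Dt β ι 1), ¬ IsOfFinAddOrder d₁.derivedPoint →
        ∀ (r : ℕ), 0 < r →
        ∀ (Mr : ℕ),
          IsLeast {u : ℕ | ∃ (n : ℕ) (d : KolyvaginHeegnerData Dt β ι n), Squarefree n ∧
              n.primeFactors.card = r ∧
              (∀ ℓ ∈ n.primeFactors, Zhang2014.IsKolyvaginPrime (W.conductorNorm ℤ) W K p ℓ ∧
                u + 1 ≤ Zhang2014.kolyvaginIndex W p ℓ) ∧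
              (∃ Q : (W.baseChange (ringClassField K ι n)).toAffine.Point,
                ((p ^ u : ℕ) : ℤ) • Q = d.derivedPoint) ∧
              ¬ ∃ Q : (W.baseChange (ringClassField K ι n)).toAffine.Point,
                ((p ^ (u + 1) : ℕ) : ℤ) • Q = d.derivedPoint} Mr →
        ∀ (M : ℕ), Mr < M →
          ∃ (n : ℕ) (d : KolyvaginHeegnerData Dt β ι n), Squarefree n ∧ n.primeFactors.card = r ∧
            (∀ ℓ ∈ n.primeFactors, Zhang2014.IsKolyvaginPrime (W.conductorNorm ℤ) W K p ℓ ∧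
              M ≤ Zhang2014.kolyvaginIndex W p ℓ) ∧
            addOrderOf (d.kolyvaginClass (Fact.out : p.Prime) M) = p ^ (M - Mr) ∧
            (∃ Q : (W.baseChange (ringClassField K ι n)).toAffine.Point,
              ((p ^ Mr : ℕ) : ℤ) • Q = d.derivedPoint) ∧
            ¬ ∃ Q : (W.baseChange (ringClassField K ι n)).toAffine.Point,
              ((p ^ (Mr + 1) : ℕ) : ℤ) • Q = d.derivedPoint)
    (h37 : GrossLMS1991.prop37_2_frobeniusCongruence)
    (hPT : ∀ (K : Type) [Field K] [NumberField K], poitouTate_selmerStructure_duality_conj K)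
    (hF1 : Gross1991_heegnerPoint_sub_ratTorsion_mem_E0_imageFree) :
    ∀ (W : WeierstrassCurve ℚ) [W.IsElliptic] [W.IsGloballyMinimal] [NeZero (W.conductorNorm ℤ)],
      ¬ W.HasCM →
      ∀ (K : Type) [Field K] [NumberField K], IsImaginaryQuadratic K →
      NumberField.discr K ≠ -3 → NumberField.discr K ≠ -4 →
      SatisfiesHeegnerHypothesis (W.conductorNorm ℤ) K →
      ∀ (p : ℕ) [Fact p.Prime], p ≠ 2 → Addv W p → 0 ≤ padicValRat p W.j →
      W.HasIrreducibleModPGaloisRep p →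
      ¬ p ∣ (W.baseChange ℚ_[p]).localTamagawaNumber ℤ_[p] →
      (∀ (q' : ℕ) [Fact q'.Prime], q' ∣ W.conductorNorm ℤ →
        p ∣ (W.baseChange ℚ_[q']).localTamagawaNumber ℤ_[q'] → ¬ q' ^ 2 ∣ W.conductorNorm ℤ) →
      ∀ (Dt : ModularParametrizationData W (W.conductorNorm ℤ)) (β : ℤ) (ι : K →+* ℂ)
        (d₁ : KolyvaginHeegnerData Dt β ι 1), ¬ IsOfFinAddOrder d₁.derivedPoint →
      ∀ (q : ℕ) [Fact q.Prime], q ∣ W.conductorNorm ℤ → ¬ q ^ 2 ∣ W.conductorNorm ℤ → q ≠ p →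
      ∀ (s : ℕ), s ≤ padicValNat p ((W.baseChange ℚ_[q]).localTamagawaNumber ℤ_[q]) →
      ∀ (n : ℕ) (d : KolyvaginHeegnerData Dt β ι n), Squarefree n →
        (∀ ℓ ∈ n.primeFactors, Zhang2014.IsKolyvaginPrime (W.conductorNorm ℤ) W K p ℓ ∧
          s ≤ Zhang2014.kolyvaginIndex W p ℓ) →
        ∃ Q : (W.baseChange (ringClassField K ι n)).toAffine.Point,
          ((p ^ s : ℕ) : ℤ) • Q = d.derivedPoint :=
  divisibilityIrredAddv_of_prop52IrredP_of_coreVertexExistenceIrredPlt_of_thm63 h52I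
    (coreVertexExistenceIrredP_lt_of_prop37_2_of_poitouTate_of_Gross1991 h37 hPT hF1)
    (fun K _ _ ι hK k ↦ Summit.BirchSwinnertonDyer.Rank1Residual.JET.numberField_ringClassField K hK ι k)
    (JetchevIrreducibleReadingThm52Gross1991.h63IRowObjectsAddv_of_prop37_2_of_poitouTate_of_Gross1991 h37 hPT hF1)

/-- **S2p of crux 19941 (the `hDp` schema: divisibility to depth `ord_p c_p(E)` at conductor level, carrier the additive `p`) ⟸ S2′ + THREE
NAMED FACTS.** Bridge `…CoreVertexBridgesAtP` fed with S3′-lt and the node `H63Ip`, both from the three facts. CONDITIONAL; nothing asserted.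
[cite: Jetchev2008, Thm. 1.4, Prop. 5.3, Thm. 5.2, Thm. 6.3] [cite: McCallumLMS1991, §5 Prop. 5.2 (p. 304)] -/
theorem divisibilityAtP_of_prop52IrredP_of_namedFacts
    (h52I : ∀ (W : WeierstrassCurve ℚ) [W.IsElliptic] [W.IsGloballyMinimal] [NeZero (W.conductorNorm ℤ)],
        ¬ W.HasCM →
        ∀ (K : Type) [Field K] [NumberField K], IsImaginaryQuadratic K →
        NumberField.discr K ≠ -3 → NumberField.discr K ≠ -4 →
        SatisfiesHeegnerHypothesis (W.conductorNorm ℤ) K →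
        ∀ (p : ℕ) [Fact p.Prime], p ≠ 2 → W.HasIrreducibleModPGaloisRep p → (p : ℤ) ∣ W.conductorNorm ℤ →
        ∀ (Dt : ModularParametrizationData W (W.conductorNorm ℤ)) (β : ℤ) (ι : K →+* ℂ)
          (d₁ : KolyvaginHeegnerData Dt β ι 1), ¬ IsOfFinAddOrder d₁.derivedPoint →
        ∀ (r : ℕ), 0 < r →
        ∀ (Mr : ℕ),
          IsLeast {u : ℕ | ∃ (n : ℕ) (d : KolyvaginHeegnerData Dt β ι n), Squarefree n ∧
              n.primeFactors.card = r ∧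
              (∀ ℓ ∈ n.primeFactors, Zhang2014.IsKolyvaginPrime (W.conductorNorm ℤ) W K p ℓ ∧
                u + 1 ≤ Zhang2014.kolyvaginIndex W p ℓ) ∧
              (∃ Q : (W.baseChange (ringClassField K ι n)).toAffine.Point,
                ((p ^ u : ℕ) : ℤ) • Q = d.derivedPoint) ∧
              ¬ ∃ Q : (W.baseChange (ringClassField K ι n)).toAffine.Point,
                ((p ^ (u + 1) : ℕ) : ℤ) • Q = d.derivedPoint} Mr →
        ∀ (M : ℕ), Mr < M →
          ∃ (n : ℕ) (d : KolyvaginHeegnerData Dt β ι n), Squarefree n ∧ n.primeFactors.card = r ∧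
            (∀ ℓ ∈ n.primeFactors, Zhang2014.IsKolyvaginPrime (W.conductorNorm ℤ) W K p ℓ ∧
              M ≤ Zhang2014.kolyvaginIndex W p ℓ) ∧
            addOrderOf (d.kolyvaginClass (Fact.out : p.Prime) M) = p ^ (M - Mr) ∧
            (∃ Q : (W.baseChange (ringClassField K ι n)).toAffine.Point,
              ((p ^ Mr : ℕ) : ℤ) • Q = d.derivedPoint) ∧
            ¬ ∃ Q : (W.baseChange (ringClassField K ι n)).toAffine.Point,
              ((p ^ (Mr + 1) : ℕ) : ℤ) • Q = d.derivedPoint)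
    (h37 : GrossLMS1991.prop37_2_frobeniusCongruence)
    (hPT : ∀ (K : Type) [Field K] [NumberField K], poitouTate_selmerStructure_duality_conj K)
    (hF1 : Gross1991_heegnerPoint_sub_ratTorsion_mem_E0_imageFree) :
    ∀ (W : WeierstrassCurve ℚ) [W.IsElliptic] [W.IsGloballyMinimal] [NeZero (W.conductorNorm ℤ)],
      ¬ W.HasCM →
      ∀ (K : Type) [Field K] [NumberField K], IsImaginaryQuadratic K →
      NumberField.discr K ≠ -3 → NumberField.discr K ≠ -4 →
      SatisfiesHeegnerHypothesis (W.conductorNorm ℤ) K →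
      ∀ (p : ℕ) [Fact p.Prime], p ≠ 2 → W.analyticRank = 0 → Addv W p → 0 ≤ padicValRat p W.j →
      W.HasIrreducibleModPGaloisRep p → ¬ (∀ n : ℕ, W.HasSurjectiveModNGaloisRep (p ^ n : ℕ)) →
      (∃ Dt : ModularParametrizationData W (W.conductorNorm ℤ),
        (∀ z ∈ Dt.L.lattice, ∃ w ∈ periodLattice Dt.f, z = (Dt.c : ℂ) * w) ∧ ¬ (p : ℤ) ∣ Dt.c) →
      ∀ (Dt : ModularParametrizationData W (W.conductorNorm ℤ)) (β : ℤ) (ι : K →+* ℂ)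
        (d₁ : KolyvaginHeegnerData Dt β ι 1), ¬ IsOfFinAddOrder d₁.derivedPoint →
      ∀ (s : ℕ), s ≤ padicValNat p ((W.baseChange ℚ_[p]).localTamagawaNumber ℤ_[p]) →
      ∀ (n : ℕ) (d : KolyvaginHeegnerData Dt β ι n), Squarefree n →
        (∀ ℓ ∈ n.primeFactors, Zhang2014.IsKolyvaginPrime (W.conductorNorm ℤ) W K p ℓ ∧
          s ≤ Zhang2014.kolyvaginIndex W p ℓ) →
        ∃ Q : (W.baseChange (ringClassField K ι n)).toAffine.Point,
          ((p ^ s : ℕ) : ℤ) • Q = d.derivedPoint :=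
  divisibilityAtP_of_prop52IrredP_of_coreVertexExistenceIrredPlt_of_thm63AtP h52I
    (coreVertexExistenceIrredP_lt_of_prop37_2_of_poitouTate_of_Gross1991 h37 hPT hF1)
    (fun K _ _ ι hK k ↦ Summit.BirchSwinnertonDyer.Rank1Residual.JET.numberField_ringClassField K hK ι k)
    (WildJetchevBoundAtPGross1991.thm63AtP_of_prop37_2_of_poitouTate_of_Gross1991 h37 hPT hF1)

end Summit.BirchSwinnertonDyer.BirchSwinnertonDyer.Theorems.JetchevIrreducibleCoreVertex

end
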